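import Mathlib.LinearAlgebra.Matrix.Permanent
import Mathlib.RingTheory.MvPolynomial.Homogeneous
import Mathlib.Data.ZMod.Basic
import Mathlib.RingTheory.MvPolynomial.Tower
import Mathlib.Analysis.Complex.Basic
import Literature.Computability.AlgebraicComplexity.ConstantFreeValiant
import Literature.Computability.AlgebraicComplexity.KaltofenFactorClosure
import Literature.Computability.Complexity.Counting
import HarnessLib

/-!
# Bläser–Ikenmeyer–Jindal–Lysikov 2018, §6–§7 and App. A: matrices with permanent zero — the
transfer theorem `VP⁰ = VNP⁰ ⇒ P^{#P} ⊆ ∃BPP`, the natural-proofs barrier for `{per = 0}`, and the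
occurrence obstruction that breaks it

Typed literature (val-lit cell, typer t23; sibling of `BIJL18MatrixCompletion.lean`, which types
§1–§5 and App. B). Source: M. Bläser, C. Ikenmeyer, G. Jindal, V. Lysikov, *Generalized matrix
completion and algebraic natural proofs*, STOC 2018 = ECCC TR18-064
[BlaserIkenmeyerJindalLysikov2018]. Locators: `ECCC p.N` (held `paper:url-fc2542cbbad3`),
`s2 pNNNN:Lnn` (held `paper:doi-10-1145-3188745-3188832`, chunk/line). HONEST FRAMING: typed
literature; `VP ≠ VNP` is NOT proved and nothing here is progress on it.

**The printed results.**
* Thm. 24 (Kaltofen [Kal89]), over `𝔽_p`: factors `gᵢ^{p^{eᵢ}}` of a size-`s`, degree-`d`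
  circuit are computable by circuits found in randomised `poly(n,s,d,log p)` time.
* Lemma 25 (Fournier–Perifel–de Verclos [FPdV13]): a circuit of size `s`, formal degree `d`,
  constants of absolute value `≤ M` (`M ≥ 2`) computes a polynomial with `Σ |coeff| ≤ M^{s·d}`.
* Thm. 5: "If `VP⁰ = VNP⁰` over characteristic zero, then `P^{#P} ⊆ ∃BPP`."
* Thm. 6: "If there are `VP⁰`-natural proofs over characteristic zero against the set of matrices
  with permanent zero, then `P^{#P} ⊆ ∃BPP`."
* §7, Prop. 26 / Thm. 7: for `G = Q_n × Q_n` (pairs of monomial matrices acting by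
  `(g₁,g₂)·A = g₁ A g₂ᵀ`) and the one-dimensional type `ν = (((1ⁿ),(n)),((1ⁿ),(n)))` (symmetric
  groups trivial, tori by `α₁⋯αₙβ₁⋯βₙ`): `mult_ν(ℂ[Z]_n) = 0` for `Z = {per = 0}`, and
  `mult_ν(ℂ[\overline{GA}]_n) = 0` if `A ∈ Z`, `= 1` otherwise; hence (Thm. 7) "There is a
  polynomial sized occurrence obstruction against the set of matrices with permanent zero" — GCT
  "breaks the natural proofs barrier" of Thm. 6 in this instance.
* App. A: Defs. 27–29 (`L`, `L⁰`, `VP`, `VP⁰`, `VNP⁰`).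

**Rendering notes (read by referees).**
* `VP⁰`, `VNP⁰` = the tree's `IsVP0Family` / `IsVNP0Family` (integer polynomials, fan-in-two
  division-free constant-free circuits of p-bounded size AND formal degree — exactly Def. 29;
  `VP⁰ ⊆ VNP⁰` is `IsVP0Family.isVNP0Family`), so "`VP⁰ = VNP⁰` over characteristic zero" is
  `VP0EqVNP0 := ∀ F, IsVNP0Family F.poly → IsVP0Family F.poly` (families bundled as
  `PolyFamily ℤ`, variables `Fin (nvars n)`). `P^{#P}` = `PSharpP`, `∃BPP` = `polyExists BPP`
  ("`∃BPP` … can be replaced by `MA` in the statements of all our results", ECCC p.2).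
* Thm. 6's hypothesis is typed as printed in §6 ("a family of polynomials `(D_n) ∈ VP⁰` such that
  `D_n` is nonzero and vanishes on all matrices with permanent `0`", matrices "say with rational
  entries"): `HasVP0NaturalProofsAgainstPerZero` — Def. 1 with `M` = the `n²` matrix entries,
  `𝒞 = Z_n(ℚ)`, `𝒟 = VP⁰`. It reaches distinguishers vanishing on the HYPERSURFACE `{per_n = 0}`,
  not distinguishers vanishing on `VP`-coefficient vectors (the route's `SuccinctHittingSetsForVP`);
  any bridge to the route is a Summits-side item, not Literature.
* Thm. 24 is an ALGORITHMIC statement (randomised time); typed is its circuit-EXISTENCE content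
  with the size bound `poly(n, s, d, log p)` in the fixed shape `(n+s+d+log₂ p+2)^κ` (cf. the
  tree's characteristic-zero `KaltofenFactorBound`). Lemma 25 is typed in the tree's circuit model
  for the case the paper uses (constant-free circuits, `M = 2`: `B := 2^{d(k)·s(k)}`, proof of
  Thm. 5 step 5), with fan-in EXACTLY two (the tree's empty product gate, value `1` of formal
  degree `0`, would break the printed bound); weighted `±1`-sums satisfy the same recursion as
  `+`/`−` gates.
* §7: `mult_ν` for the ONE-DIMENSIONAL type `ν` is rendered as `dim W_d − dim (W_d ∩ I(Y))`,
  `W_d` = the `χ_ν`-semi-invariant forms of degree `d` (`χ_ν(g₁,g₂) = per g₁ · per g₂ = Πα·Πβ`);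
  for the linearly reductive `G` and a `G`-stable `Y` this IS the multiplicity of `ν` in
  `ℂ[Y]_d = ℂ[x]_d / I(Y)_d` (Schur's lemma and complete reducibility, as invoked on ECCC p.21).
  `I(\overline{GA}) = I(GA)`, so `ℂ[\overline{GA}]_d` is computed from the orbit.
* Cited, not restated: `perPoly`, `Matrix.permanent`, `complexity` (Def. 27's `L`, up to a factor
  `≤ 3`), `constantFreeComplexity` (`L⁰`), `IsVPFamily`/`VP` (Def. 28), `IsVP0Family`,
  `IsVNP0Family` (Def. 29), `KaltofenFactorBound` (char. `0` form of Thm. 24).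
* FACT-LIST marks as in the sibling file.

## References
* [BlaserIkenmeyerJindalLysikov2018] §6 (Thm. 24, Lemma 25, Thms. 5–6 with proofs), §7
  (Prop. 26, Thm. 7), App. A (Defs. 27–29).
* [Kaltofen1989], [Burgisser2024Completeness] Thm. 3.2 (tree file `KaltofenFactorClosure.lean`).
* [Burgisser2006] Def. 2.7–2.8 (`VP⁰`, `VNP⁰`; tree file `ConstantFreeValiant.lean`).
-/

noncomputable section

namespace Literature.Barriers.ValiantsHypothesis

open Literature.Computability.AlgebraicComplexity Literature.Computability.Complexity MvPolynomial
open _root_.Computability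

universe u v

/-! ### §6: the self-reduction matrix `Z(X)`, Thm. 24, Lemma 25, Thm. 5, Thm. 6 -/

section Transfer

-- PROVED (definition)
/-- **The matrix `Z = Z(X)` of §6** (ECCC p.18) for an `(n+1) × (n+1)` matrix `X` (last index =
the paper's `n`): `z_{ij} = x_{ij}` for `i ≤ n−1`; `z_{nj} = x_{nj} · Per(X_{nn})` for `j ≤ n−1`;
`z_{nn} = − Σ_{j ≤ n−1} x_{nj} · Per(X_{nj})`, where `X_{ij}` is `X` with row `i` and column `j`
removed. [cite: BlaserIkenmeyerJindalLysikov2018, §6 (construction of `Z`)] locator: ECCC p.18; s2 p0015.txt:L3 -/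
def zMatrix {R : Type u} [CommRing R] {n : ℕ} (X : Matrix (Fin (n + 1)) (Fin (n + 1)) R) :
    Matrix (Fin (n + 1)) (Fin (n + 1)) R :=
  fun i j =>
    if i ≠ Fin.last n then X i j
    else if j ≠ Fin.last n then
      X i j * (X.submatrix (Fin.last n).succAbove (Fin.last n).succAbove).permanent
    else -∑ j' : Fin n, X (Fin.last n) (Fin.castSucc j') *
      (X.submatrix (Fin.last n).succAbove (Fin.castSucc j').succAbove).permanent

-- DISCHARGEABLE (Laplace expansion of the permanent along the last row; M-sized)
/-- **§6, properties of `Z(X)`**: "We have `Per Z = 0`. Moreover, any matrix with `Per Z = 0` and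
`Per Z_{nn} ≠ 0` can be obtained in this way, by Laplace expansion." (Over a field.)
[cite: BlaserIkenmeyerJindalLysikov2018, §6 (construction of `Z`)] locator: ECCC p.18 -/
def BIJL2018_sec6_zMatrix (K : Type u) [Field K] : Prop :=
  ∀ n : ℕ, (∀ X : Matrix (Fin (n + 1)) (Fin (n + 1)) K, (zMatrix X).permanent = 0) ∧
    ∀ Z : Matrix (Fin (n + 1)) (Fin (n + 1)) K, Z.permanent = 0 →
      (Z.submatrix (Fin.last n).succAbove (Fin.last n).succAbove).permanent ≠ 0 →
      ∃ X : Matrix (Fin (n + 1)) (Fin (n + 1)) K, zMatrix X = Z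

-- FACT (algorithmic statement; only its circuit-existence content is typed)
/-- **BIJL Thm. 24 (Kaltofen [Kal89]), existence content.** "If `f ∈ 𝔽_p[x₁, …, x_n]` can be
computed by an arithmetic circuit of size at most `s` and degree at most `d`,
`f = Πᵢ gᵢ^{p^{eᵢ}·jᵢ}`, where the `gᵢ`'s are irreducible and `p ∤ jᵢ` for each `i`. Then we can
compute, for each `i`, the numbers `eᵢ, jᵢ`, and an arithmetic circuit for the factor `gᵢ^{p^{eᵢ}}`
in randomized `poly(n, s, d, log p)` time." Typed consequence: such a circuit (of size at most the
running time) EXISTS — for one absolute exponent `κ`, every irreducible `g` dividing `f` with exact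
multiplicity `p^e·j`, `p ∤ j`, has `L(g^{p^e}) ≤ (n + s + d + log₂ p + 2)^κ` (`L = complexity`,
degree = total degree of `f`). The randomised algorithm itself is not formalised.
[cite: BlaserIkenmeyerJindalLysikov2018, Thm. 24] locator: ECCC p.18; s2 p0015.txt:L7 -/
def BIJL2018_thm24 : Prop :=
  ∃ κ : ℕ, ∀ (p : ℕ) [Fact p.Prime] (n : ℕ) (f g : MvPolynomial (Fin n) (ZMod p)) (e j : ℕ),
    f ≠ 0 → Irreducible g → ¬ p ∣ j → g ^ (p ^ e * j) ∣ f → ¬ g ^ (p ^ e * j + 1) ∣ f →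
      complexity (g ^ p ^ e) ≤ (n + complexity f + f.totalDegree + Nat.log 2 p + 2) ^ κ

/-- The sum of the absolute values of the coefficients of an integer polynomial.
[cite: BlaserIkenmeyerJindalLysikov2018, Lemma 25] locator: ECCC p.18 -/
def coeffAbsSum {σ : Type v} (P : MvPolynomial σ ℤ) : ℤ :=
  ∑ m ∈ P.support, |coeff m P|

-- DISCHARGEABLE (induction along the circuit; M-sized)
/-- **BIJL Lemma 25 (Fournier–Perifel–de Verclos [FPdV13]), constant-free case `M = 2`.**
Printed: "Let `P` be a polynomial computed by an arithmetic circuit of size `s` and formal degree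
`d` with constants of absolute value bounded by `M ≥ 2`, then the sum of the absolute values of
its coefficients is at most `M^{s·d}`." Typed in the tree's circuit model for the case used in the
paper (constant-free circuits, `M = 2`): a fan-in-EXACTLY-two circuit over `ℤ` with sign constants
(`HasSignConstants`: constants and sum coefficients in `{0, 1, -1}`) of size `s` and formal degree
`d` computes `P` with `Σ |coeff| ≤ 2^{s·d}` (module docstring on the model).
[cite: BlaserIkenmeyerJindalLysikov2018, Lemma 25] locator: ECCC p.18; s2 p0015.txt:L11 -/
def BIJL2018_lemma25 (σ : Type v) : Prop :=
  ∀ P : ArithCircuit ℤ σ, (∀ g ∈ P.gates, g.fanIn = 2) → P.HasSignConstants →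
    coeffAbsSum P.eval ≤ 2 ^ (P.size * P.formalDegree)

-- PROVED (definition)
/-- **"`VP⁰ = VNP⁰`"** (over characteristic zero, i.e. for integer polynomial families): every
`VNP⁰` family is in `VP⁰` (the converse inclusion `VP⁰ ⊆ VNP⁰` is the tree's
`IsVP0Family.isVNP0Family`). Families are bundled as `PolyFamily ℤ` (variables `Fin (nvars n)`).
Valiant's hypothesis in the constant-free setting is its negation (App. A: "Valiant's Hypothesis
states that `(Per_n) ∉ VP⁰` or even `(Per_n) ∉ VP`"). [cite: BlaserIkenmeyerJindalLysikov2018, Thm. 5 and Def. 29]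
locator: ECCC p.6, p.26 -/
def VP0EqVNP0 : Prop :=
  ∀ F : PolyFamily ℤ, IsVNP0Family F.poly → IsVP0Family F.poly

-- FACT (R1: Boolean class conclusion; uses Thm. 24, Lemma 25, PIT)
/-- **BIJL Thm. 5 (transfer theorem).** "If `VP⁰ = VNP⁰` over characteristic zero, then
`P^{#P} ⊆ ∃BPP`." (Proof, §6: guess constant-free circuits for `Per_k`, `k ≤ n`, verify
`C_k(Z_k(X)) = 0` by PIT, factor with Kaltofen over `𝔽_p`, `p > max{2^{d(k)s(k)}, n!}`.)
Strengthens Grochow–Pitassi's `VP⁰ = VNP⁰ ⇒ coNP ⊆ ∃BPP`.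
[cite: BlaserIkenmeyerJindalLysikov2018, Thm. 5] locator: ECCC p.6 (proof pp.18–19); s2 p0005.txt:L15 -/
def BIJL2018_thm5 : Prop :=
  VP0EqVNP0 → PSharpP ⊆ polyExists BPP

-- PROVED (definition) — the hypothesis of the LOAD-BEARING Thm. 6
/-- **Hypothesis of Thm. 6: `VP⁰`-natural proofs against `{A : Per(A) = 0}`** (§6, ECCC p.17:
"algebraic `VP⁰`-natural proofs for the set of all matrices `A`, say with rational entries, that
fulfill `Per(A) = 0` … a family of polynomials `(D_n) ∈ VP⁰` such that `D_n` is nonzero and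
vanishes on all matrices with permanent `0`"): a `VP⁰` family `D_n ∈ ℤ[x_{11}, …, x_{nn}]` with
`D_n ≠ 0` and `D_n(A) = 0` for every `A ∈ ℚ^{n×n}` with `per A = 0` (Def. 1 with `𝒞 = Z_n(ℚ)`,
`𝒟 = VP⁰`, coordinates = matrix entries). ("Note that this set has a `VNP⁰`-natural proof, namely
the permanent itself.") [cite: BlaserIkenmeyerJindalLysikov2018, Thm. 6 and §6]
locator: ECCC p.7, p.17, p.19; s2 p0015.txt:L3 -/
def HasVP0NaturalProofsAgainstPerZero : Prop :=
  ∃ D : ∀ n : ℕ, MvPolynomial (Fin n × Fin n) ℤ, IsVP0Family D ∧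
    ∀ n, D n ≠ 0 ∧ ∀ A : Matrix (Fin n) (Fin n) ℚ, A.permanent = 0 →
      aeval (fun ij : Fin n × Fin n => A ij.1 ij.2) (D n) = 0

-- FACT (R1: Boolean class conclusion) — LOAD-BEARING (GAP-LEDGER N6); a CONDITIONAL barrier
/-- **BIJL Thm. 6 (natural-proofs barrier for `{per = 0}`).** "If there are `VP⁰`-natural proofs
over characteristic zero against the set of matrices with permanent zero, then `P^{#P} ⊆ ∃BPP`."
technique_class: `VP⁰`-natural proofs (nonzero constant-free p-bounded-size-and-formal-degree
integer polynomial families `D_n`) vanishing on the hypersurface `Z_n = {A ∈ ℚ^{n×n} : per A = 0}`.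
blocks: `VP⁰`-size equations for the variety of permanent-zero matrices (equivalently small
constant-free multiples of `per_n`, by irreducibility), unless `P^{#P} ⊆ ∃BPP`
[cite: BlaserIkenmeyerJindalLysikov2018, Thm. 6]. because: a guessed `VP⁰`-circuit vanishing on
`Z_k` is verified on the self-reduction `Z_k(X)` by PIT and factored (Kaltofen over `𝔽_p`,
`p > 2^{s·d}` by Lemma 25) to a circuit for `per_k`, placing `P^{#P}` in `∃BPP`
[cite: BlaserIkenmeyerJindalLysikov2018, §6 (proofs of Thms. 5–6)]. evasions_known: GCT
occurrence obstructions — the type `ν` is a polynomial-size certificate for every `A ∉ Z`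
(Prop. 26, Thm. 7: "geometric complexity theory breaks the natural proofs barrier" here; its
verification is hard) [cite: BlaserIkenmeyerJindalLysikov2018, §7]. scope_caveats: conditional
on `P^{#P} ⊄ ∃BPP`; constant-free distinguishers of p-bounded FORMAL degree; the variety is
`{per = 0}`, not a circuit class — nothing is said about equations for `VP`. status: established
(conditional theorem). [cite: BlaserIkenmeyerJindalLysikov2018, Thm. 6]
locator: ECCC p.7 (proof p.19); s2 p0005.txt:L17, p0015.txt:L25 -/
def BIJL2018_thm6 : Prop :=
  HasVP0NaturalProofsAgainstPerZero → PSharpP ⊆ polyExists BPP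

/-- The permanent commutes with ring homomorphisms applied entrywise. [folklore] -/
private theorem permanent_map {m : Type*} [Fintype m] [DecidableEq m] {R S : Type*} [CommRing R]
    [CommRing S] (f : R →+* S) (A : Matrix m m R) : (A.map f).permanent = f A.permanent := by
  simp [Matrix.permanent, map_sum, map_prod, Matrix.map_apply]

/-- **Thm. 6's hypothesis in §7's phrasing (complex points)** — ECCC p.19: "Let `Z ⊆ ℂ^{n×n}` be
the variety of matrices with permanent zero. Theorem 6 shows that if `Z` has `VP⁰`-natural proofs,
then `P^{#P} ⊆ ∃BPP`": a `VP⁰` family of nonzero `D_n` vanishing at every COMPLEX matrix of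
permanent zero vanishes in particular at the rational ones, i.e. gives
`HasVP0NaturalProofsAgainstPerZero` (§6, "say with rational entries"; the converse holds by
Zariski density of `Z(ℚ)` in `Z`, not proved here).
[cite: BlaserIkenmeyerJindalLysikov2018, Thm. 6 and §7] locator: ECCC pp.17, 19; s2 p0016.txt:L5 -/
theorem hasVP0NaturalProofsAgainstPerZero_of_complex
    (h : ∃ D : ∀ n : ℕ, MvPolynomial (Fin n × Fin n) ℤ, IsVP0Family D ∧
      ∀ n, D n ≠ 0 ∧ ∀ A : Matrix (Fin n) (Fin n) ℂ, A.permanent = 0 →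
        aeval (fun ij : Fin n × Fin n => A ij.1 ij.2) (D n) = 0) :
    HasVP0NaturalProofsAgainstPerZero := by
  obtain ⟨D, hD, h⟩ := h
  refine ⟨D, hD, fun n => ⟨(h n).1, fun A hA => ?_⟩⟩
  have hC := (h n).2 (A.map (algebraMap ℚ ℂ)) (by rw [permanent_map, hA, map_zero])
  have e : (fun ij : Fin n × Fin n => A.map (algebraMap ℚ ℂ) ij.1 ij.2) =
      algebraMap ℚ ℂ ∘ fun ij : Fin n × Fin n => A ij.1 ij.2 := rfl
  rwa [e, MvPolynomial.aeval_algebraMap_eq_zero_iff] at hC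

/-- **Thm. 6 over complex points** (§7's phrasing) follows from the §6 (rational-points)
statement `BIJL2018_thm6`. [cite: BlaserIkenmeyerJindalLysikov2018, Thm. 6 and §7] locator: ECCC p.19 -/
theorem BIJL2018_thm6.complex (h : BIJL2018_thm6)
    (hc : ∃ D : ∀ n : ℕ, MvPolynomial (Fin n × Fin n) ℤ, IsVP0Family D ∧
      ∀ n, D n ≠ 0 ∧ ∀ A : Matrix (Fin n) (Fin n) ℂ, A.permanent = 0 →
        aeval (fun ij : Fin n × Fin n => A ij.1 ij.2) (D n) = 0) :
    PSharpP ⊆ polyExists BPP :=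
  h (hasVP0NaturalProofsAgainstPerZero_of_complex hc)

end Transfer

/-! ### §7: the occurrence obstruction against `{per = 0}` (Prop. 26, Thm. 7) -/

section GCT

variable (n : ℕ)

/-- The monomial matrix `P_π · diag(α)`: entry `(i, j)` is `α_j` if `i = π j`, else `0`.
[cite: BlaserIkenmeyerJindalLysikov2018, §7 (the group `Q_n`)] locator: ECCC p.20; s2 p0016.txt:L9 -/
def monomialMat (π : Equiv.Perm (Fin n)) (α : Fin n → ℂ) : Matrix (Fin n) (Fin n) ℂ :=
  fun i j => if i = π j then α j else 0

/-- **`Q_n ⊆ GL_n`**: "the group of monomial matrices, i.e., matrices with nonzero determinant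
that have a single nonzero entry in each row and column" (`≅ T_n ⋊ S_n`).
[cite: BlaserIkenmeyerJindalLysikov2018, §7] locator: ECCC p.20 -/
def Qn : Set (Matrix (Fin n) (Fin n) ℂ) :=
  {g | ∃ (π : Equiv.Perm (Fin n)) (α : Fin n → ℂ), (∀ j, α j ≠ 0) ∧ g = monomialMat n π α}

/-- **`G := Q_n × Q_n ⊆ GL_n × GL_n`.** [cite: BlaserIkenmeyerJindalLysikov2018, §7] locator: ECCC p.20 -/
def bijlG : Set (Matrix (Fin n) (Fin n) ℂ × Matrix (Fin n) (Fin n) ℂ) :=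
  {g | g.1 ∈ Qn n ∧ g.2 ∈ Qn n}

/-- The action of `GL_n × GL_n` on `ℂ^{n×n}`: "`(g₁, g₂)·A := g₁ A g₂ᵀ`".
[cite: BlaserIkenmeyerJindalLysikov2018, §7] locator: ECCC p.20 -/
def gAct (g : Matrix (Fin n) (Fin n) ℂ × Matrix (Fin n) (Fin n) ℂ) (A : Matrix (Fin n) (Fin n) ℂ) :
    Matrix (Fin n) (Fin n) ℂ :=
  g.1 * A * g.2.transpose

/-- **`Z ⊆ ℂ^{n×n}`, the variety of matrices with permanent zero.**
[cite: BlaserIkenmeyerJindalLysikov2018, §7] locator: ECCC p.19 -/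
def perZero : Set (Matrix (Fin n) (Fin n) ℂ) := {A | A.permanent = 0}

/-- The orbit `GA := {gA | g ∈ G}` (its Zariski closure `\overline{GA}` has the same vanishing
ideal). [cite: BlaserIkenmeyerJindalLysikov2018, §7] locator: ECCC p.20 -/
def gOrbit (A : Matrix (Fin n) (Fin n) ℂ) : Set (Matrix (Fin n) (Fin n) ℂ) :=
  {B | ∃ g ∈ bijlG n, B = gAct n g A}

/-- **The action of `G` on `ℂ[ℂ^{n×n}] = ℂ[x_{11}, …, x_{nn}]` by the canonical pullback**
"`(g f)(B) := f(gᵀ B)`", `gᵀ = (g₁ᵀ, g₂ᵀ)`, i.e. `f ↦ f(g₁ᵀ X g₂)`: the algebra map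
`x_{ij} ↦ Σ_{k,l} (g₁)_{ki} (g₂)_{lj} x_{kl}`. [cite: BlaserIkenmeyerJindalLysikov2018, §7 (canonical pullback)]
locator: ECCC p.20 -/
def gActPoly (g : Matrix (Fin n) (Fin n) ℂ × Matrix (Fin n) (Fin n) ℂ) :
    MvPolynomial (Fin n × Fin n) ℂ →ₐ[ℂ] MvPolynomial (Fin n × Fin n) ℂ :=
  aeval fun ij => ∑ k : Fin n, ∑ l : Fin n, C (g.1 k ij.1 * g.2 l ij.2) * X (k, l)

/-- **The character of the type `ν := (((1ⁿ), (n)), ((1ⁿ), (n)))`**: "The irreducible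
`G`-representation `V` of type `ν` is `1`-dimensional, `V = ⟨f⟩`, where the symmetric groups act
trivially and the tori act by rescaling: `(π, diag(α₁,…,αₙ); σ, diag(β₁,…,βₙ)) f = α₁⋯αₙβ₁⋯βₙ f`";
for monomial `g₁ = P_π diag(α)`, `g₂ = P_σ diag(β)` this scalar is `per(g₁) · per(g₂)`.
[cite: BlaserIkenmeyerJindalLysikov2018, §7 (the type ν)] locator: ECCC p.21; s2 p0016.txt:L17 -/
def charNu (g : Matrix (Fin n) (Fin n) ℂ × Matrix (Fin n) (Fin n) ℂ) : ℂ :=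
  g.1.permanent * g.2.permanent

-- PROVED (definition)
/-- **The `ν`-isotypic (semi-invariant) forms of degree `d`**: homogeneous `f` of degree `d` with
`g·f = χ_ν(g) f` for all `g ∈ G` — the sum of the irreducible subrepresentations of type `ν` in
`ℂ[ℂ^{n×n}]_d` (the `W` of the proof of Prop. 26 when `d = n`).
[cite: BlaserIkenmeyerJindalLysikov2018, Prop. 26 (proof: `W := (ℂ[ℂ^{n×n}]_n)_ν`)] locator: ECCC p.22 -/
def semiInvNu (d : ℕ) : Submodule ℂ (MvPolynomial (Fin n × Fin n) ℂ) where
  carrier := {f | f.IsHomogeneous d ∧ ∀ g ∈ bijlG n, gActPoly n g f = charNu n g • f}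
  add_mem' {a b} ha hb := ⟨ha.1.add hb.1, fun g hg => by
    rw [map_add, ha.2 g hg, hb.2 g hg, smul_add]⟩
  zero_mem' := ⟨isHomogeneous_zero _ _ _, fun g _ => by simp⟩
  smul_mem' c {f} hf := ⟨by simpa [MvPolynomial.smul_eq_C_mul] using (isHomogeneous_C _ c).mul hf.1,
    fun g hg => by rw [map_smul, hf.2 g hg, smul_comm]⟩

-- PROVED (definition)
/-- The vanishing ideal `I(Y) ⊆ ℂ[x_{11}, …, x_{nn}]` of a set `Y` of matrices.
[cite: BlaserIkenmeyerJindalLysikov2018, §7 ("`I(Y)` denote the vanishing ideal of `Y`")] locator: ECCC p.20 -/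
def matVanishingIdeal (Y : Set (Matrix (Fin n) (Fin n) ℂ)) : Ideal (MvPolynomial (Fin n × Fin n) ℂ) where
  carrier := {f | ∀ B ∈ Y, eval (fun ij : Fin n × Fin n => B ij.1 ij.2) f = 0}
  add_mem' {a b} ha hb := fun B hB => by simp [ha B hB, hb B hB]
  zero_mem' := fun B _ => by simp
  smul_mem' c {f} hf := fun B hB => by simp [hf B hB]

-- PROVED (definition; theorem-as-definition for the one-dimensional type, see module docstring)
/-- **`mult_ν(ℂ[Y]_d)`** for a `G`-stable `Y` (`Y = Z` or `Y = \overline{GA}`), rendered for the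
one-dimensional type `ν` as `dim W_d − dim (W_d ∩ I(Y))`, `W_d = semiInvNu n d`: the multiplicity
of `ν` in `ℂ[Y]_d := ℂ[ℂ^{n×n}]_d / I(Y)_d` ("for each type `λ` the multiplicity `mult_λ(V)` of `λ`
in `V` is unique", by linear reductivity of `G`, ECCC p.21). The subtraction does not truncate
(`W_d ∩ I(Y) ≤ W_d`, both finite-dimensional inside the degree-`d` forms).
[cite: BlaserIkenmeyerJindalLysikov2018, §7 (multiplicities, (2)–(4))] locator: ECCC pp.20–21 -/
def multNu (Y : Set (Matrix (Fin n) (Fin n) ℂ)) (d : ℕ) : ℕ :=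
  Module.finrank ℂ (semiInvNu n d) -
    Module.finrank ℂ ↥(semiInvNu n d ⊓ (matVanishingIdeal n Y).restrictScalars ℂ)

-- DISCHARGEABLE (weight computation: `W_n = ℂ·per_n`; M/L-sized)
/-- **BIJL Prop. 26.** "Let `G` be the group `G := Q_n × Q_n`. We fix the type
`ν := (((1ⁿ), (n)), ((1ⁿ), (n)))`. We have • `mult_ν(ℂ[Z]_n) = 0` and
• `mult_ν(ℂ[GA]_n) = 0` if `A ∈ Z`, `1` otherwise." (Proof: by Schur–Weyl duality and Gay's
theorem `W := (ℂ[ℂ^{n×n}]_n)_ν` is the line spanned by the permanent.)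
[cite: BlaserIkenmeyerJindalLysikov2018, Prop. 26] locator: ECCC p.21 (proof pp.21–22); s2 p0016.txt:L29 -/
def BIJL2018_prop26 : Prop :=
  ∀ n : ℕ, multNu n (perZero n) n = 0 ∧
    ∀ A : Matrix (Fin n) (Fin n) ℂ,
      (A ∈ perZero n → multNu n (gOrbit n A) n = 0) ∧ (A ∉ perZero n → multNu n (gOrbit n A) n = 1)

-- DISCHARGEABLE (immediate from Prop. 26: `BIJL2018_thm7_of_prop26`)
/-- **BIJL Thm. 7.** "There is a polynomial sized occurrence obstruction against the set of matrices
with permanent zero": for every `n` and every `A ∉ Z`, the type `ν` (an `O(n)`-size datum) in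
degree `n` is an OCCURRENCE obstruction in the sense of (4) — `mult_ν(ℂ[Z]_n) = 0 <
mult_ν(ℂ[\overline{GA}]_n)` — which proves `A ∉ Z` ("Proposition 26 says that if `A ∉ Z`, then this
can be shown using (4), which can be thought of as a succinct presentation of the permanent … So
while it is a short proof, its verification is hard", ECCC pp.21–22).
[cite: BlaserIkenmeyerJindalLysikov2018, Thm. 7] locator: ECCC p.7, p.22; s2 p0005.txt:L19 -/
def BIJL2018_thm7 : Prop :=
  ∀ (n : ℕ) (A : Matrix (Fin n) (Fin n) ℂ), A ∉ perZero n →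
    multNu n (perZero n) n = 0 ∧ 0 < multNu n (gOrbit n A) n

/-- "Now Theorem 7 immediately follows from Proposition 26."
[cite: BlaserIkenmeyerJindalLysikov2018, Thm. 7 (proof)] locator: ECCC p.22 -/
theorem BIJL2018_thm7_of_prop26 (h : BIJL2018_prop26) : BIJL2018_thm7 := by
  intro n A hA
  obtain ⟨hZ, hGA⟩ := h n
  refine ⟨hZ, ?_⟩
  rw [(hGA A).2 hA]
  exact Nat.one_pos

end GCT

end Literature.Barriers.ValiantsHypothesis

end
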